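import Summits.BirchSwinnertonDyer.BirchSwinnertonDyer.Theses.QuadraticBranchSignedControl
import Summits.BirchSwinnertonDyer.Rank1Residual.Additive.QuadraticBranchEvenMissingPPart
import Summits.BirchSwinnertonDyer.Rank1Residual.Additive.QuadraticBranchPlusLFunctionExistence
import Summits.BirchSwinnertonDyer.Rank1Residual.Additive.QuadraticBranchPeriodRatioOfManinFact
import Summits.BirchSwinnertonDyer.Rank1Residual.O5.GssTwistDictionary
import Literature.NumberTheory.EllipticCurves.SupersingularDensitySerreFrobeniusProofs
import HarnessLib

/-!
# Route `QuadraticBranchSignedControl` (rung K8, cell `bsd-potss`): the load-bearing support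
# `Gss2Assembly` (item stmt-BirchSwinnertonDyer-19119) — the PAIR theorem, with the one analytic
# input the item's published-inputs list does not carry DISPLAYED

WHAT. For every `W/ℚ` (globally minimal), every prime `p ≥ 5` with `W` additive at `p` in the census
cell `(G) ∧ ss` (`SubGss W p`: `W` is the `χ_{p*}`-twist of a curve `V` with GOOD SUPERSINGULAR
reduction at `p`, `a_p(V) = 0`), and `r_an(W) ≤ 1`:
**`ord_p #Ш(W) = ord_p #Ш_an(W)`** (`Typed.MissingPPartAt W p`) follows from
* the four K8 cruxes BY NAME — (C1_η) `PlusMainConjectureBranch`, (MC±_η) `EtaTransportSigned`,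
  (R2±) `NoFiniteSubmoduleSigned`, (GZ_p⁻) `PAdicGrossZagierBranch`;
* the five published inputs of `PublishedInputsGss2`, taken one by one (GZK, modularity as
  analytic continuation, modularity as the newform of `V`, Gross–Zagier I.(7.3), Poitou–Tate);
* ONE displayed analytic existence binder `hper` at `p`: for every globally minimal good `a_p = 0`
  curve `V` at `p` and its newform `f`, a `p`-INTEGRAL rational period ratio `ϖ` of the parity of
  `η = ω^{(p−1)/2}` (`ϖ·Ω_V⁺ = Ω_f⁺` if `p ≡ 1 (mod 4)`, `ϖ·|Ω_V⁻| = Ω_f⁻` if `p ≡ 3 (mod 4)`,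
  `‖ϖ‖_p ≤ 1`).
The binder `hper` is EXACTLY what the item's list `PublishedInputsGss2` lacks: the branch functions
`L_p^±(V, η, X) ∈ Λ = ℤ_p⟦X⟧` quantified by (C1_η)/(MC±_η) exist (Kobayashi Thm. 3.2 = Pollack, tree
theorems `exists_isQuadraticBranch{Plus,Minus}LFunction_of_isNewformOf`) only for a `p`-integral `ϖ`,
and `p`-integrality of `Ω_f^±/Ω_V^±` is the Manin-constant statement `p ∤ c₀` (Mazur 1978 Cor. 4.1,
tree named fact `ModularForms.mazur_not_dvd_maninConstant_of_odd`, through x1b's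
`periodRatio_of_mazur`) — a published theorem with no `_holds` in the tree. The sibling file
`QuadraticBranchSignedControlGss2AssemblyOfPeriodRatio.lean` turns this pair theorem into
`Gss2Assembly` modulo `hper` / modulo Mazur's fact / modulo the two Greenberg–Vatsal period facts.

PROOF. The twin `V` and `C • W^{(p*)} = V` are PRODUCED (`O5.exists_goodSS_twist_pStar_of_subGss`,
Néron model + the census dictionary), `a_p(V) = 0` by Hasse at `p ≥ 5`
(`natCast_dvd_frobeniusTrace_iff_eq_zero`), (C1_η) at `V` from the crux. Rank `0`: the newform
(`hnf`), `ϖ` (`hper`), `L_p⁺(V, η, X)` (`exists_isQuadraticBranchPlusLFunction_of_isNewformOf`),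
`L(W,1) ≠ 0` (modularity + `r_an = 0`), then the cell's EXACT even control from (MC⁺_η) + (R2⁺) +
Poitou–Tate (`EvenControlZero.quadraticBranchEvenExactControlOfPlusMCAt_of_readings`, ctrl g2, with
(R1⁺) from `EtaTransportSigned.1` by `SignedTwist.evenBranchPlusCharIdealOfPlusMCAt_of_plusMCEta` and
(R2⁺) = `NoFiniteSubmoduleSigned.1`) and the value identity, packaged as
`EvenControlZero.missingPPartAt_rankZero_of_readings`. Rank `1`: x1b's chain
`LevelBridge.bsdp_of_plusMC_of_pAdicGrossZagierValuation_of_readings_of_periodRatio` (newform, `ϖ`,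
`L_p⁻`, generator and level produced inside) with (R2⁻) = `NoFiniteSubmoduleSigned.2`, the exact
odd-`η` reading from `EtaTransportSigned.2` by `LevelBridge.exactOddBranchReading_of_kobayashi74OddEtaExact`,
C-cc-1 = `PAdicGrossZagierBranch` (`quadraticBranchPAdicGrossZagierValuationAt_iff`), then
`missingPPartAt_of_bsdp` (Ш finite by GZK).

HONEST FRAMING (cell `bsd-potss`, run/shared/lean/pub/bsd-potss/): TOOL THEOREM ONLY — no definition,
no named Literature fact introduced, no `sorry`, axioms standard. CONDITIONAL on every displayed
hypothesis: the four cruxes are OPEN route items (conjectures in print / the cell's own conjecture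
C-cc-1), the five published inputs and `hper` are hypotheses. Nothing is booked; no label / mark /
count moves; `BSD(W, p)` is NOT claimed for any pair. Seat `bsd-potss-ctrl` generation 3.

References: [Kobayashi2003] Thm. 3.2 (p. 7), §4 (p. 8), Thm. 7.4 (p. 13), Thm. 9.3 (p. 26);
[KitajimaOtsuki2018] Main Thm. 1.3; [Mazur1978] Cor. 4.1; [GreenbergVatsal2000] §3 Rem. 3.4;
[MilneADT2006] I Thm. 4.10; [GrossZagier1986] Thm. I.(7.3); [Miller2011LMS] §1, Def. 1.1;
[Serre1981] §8.1–8.2.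
-/

set_option autoImplicit false
set_option linter.dupNamespace false

noncomputable section

open scoped Classical MatrixGroups ModularForm

open CongruenceSubgroup WeierstrassCurve
open Literature.NumberTheory.EllipticCurves
open Literature.NumberTheory.EllipticCurves.ModularForms
open Literature.NumberTheory.EllipticCurves.Kobayashi2003
open Literature.NumberTheory.EllipticCurves.Rank1Residual
open Literature.NumberTheory.EllipticCurves.Rank1Residual.Typed
open Literature.NumberTheory.GaloisRepresentations
open Literature.NumberTheory.GaloisCohomology
open Summit.BirchSwinnertonDyer.Rank1Residual.Additive
open Summit.BirchSwinnertonDyer.BirchSwinnertonDyer.Theses.QuadraticBranchSignedControl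

namespace Summit.BirchSwinnertonDyer.BirchSwinnertonDyer.Theorems

/-- **`ord_p #Ш(W) = ord_p #Ш_an(W)` on every Gss2 pair of analytic rank `≤ 1`, `p ≥ 5`, from the
four K8 cruxes, the five published inputs and ONE displayed `p`-integral period-ratio binder `hper`
at `p`** (the pair content of the support `Gss2Assembly`, item stmt-BirchSwinnertonDyer-19119). The
good supersingular twin `V`, its newform, `ϖ`, the branch functions `L_p^±(V, η, X)`, the generator and
its level are PRODUCED; rank `0` through the cell's EXACT even control from (MC⁺_η) + (R2⁺) +
Poitou–Tate and the value identity, rank `1` through x1b's odd-branch chain with the exact odd control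
from (MC⁻_η) + (R2⁻) + Poitou–Tate. CONDITIONAL on every displayed hypothesis; nothing booked.
[cite: Kobayashi2003, Thm. 3.2 (p. 7), §4 (p. 8), Thm. 7.4 (p. 13), Thm. 9.3 (p. 26)]
[cite: KitajimaOtsuki2018, Main Thm. 1.3 (arXiv:1607.03612 p. 3)] [cite: MilneADT2006, I Thm. 4.10]
[cite: GrossZagier1986, Thm. I.(7.3) (p. 230)] [cite: Miller2011LMS, §1 and Def. 1.1]
[cite: Serre1981, §8.1–8.2 (pp. 188–189)] -/
theorem missingPPartAt_of_signedControlCruxes_of_periodRatio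
    (hGZK : rank_eq_analyticRank_of_analyticRank_le_one) (hmod : hasEntireLFunction_rat)
    (hnf : exists_isNewformOf) (hGZ : GrossZagier1986_thm_I_7_3)
    (hPT : poitouTate_selmerStructure_duality_real ℚ)
    (h₁ : PlusMainConjectureBranch) (h₂ : EtaTransportSigned) (h₃ : NoFiniteSubmoduleSigned)
    (h₄ : PAdicGrossZagierBranch)
    (W : WeierstrassCurve ℚ) [W.IsElliptic] [W.IsGloballyMinimal] (p : ℕ) [Fact p.Prime]
    (hper : ∀ (V : WeierstrassCurve ℚ) [V.IsElliptic] [V.IsGloballyMinimal]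
      {N : ℕ} [NeZero N] (f : CuspForm (Gamma0 N) 2), IsNewformOf V f →
      V.HasGoodReductionAtPrime p → V.frobeniusTrace p = 0 →
      ∃ ϖ : ℚ, ‖(ϖ : ℚ_[p])‖ ≤ 1 ∧
        (if Even (p / 2) then (ϖ : ℝ) * V.realPeriodRat = plusPeriod f
          else (ϖ : ℝ) * V.imaginaryPeriodRat = minusPeriod f))
    (hr : W.analyticRank ≤ 1) (hp5 : 5 ≤ p) (hadd : Addv W p) (hGss : SubGss W p) :
    MissingPPartAt W p := by
  have hp2 : p ≠ 2 := by omega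
  -- the good supersingular `p*`-twin `V` (Néron model of `W^{(p*)}`); `a_p(V) = 0` by Hasse at `p ≥ 5`
  obtain ⟨V, hVe, hVm, C, hCV, hss⟩ :=
    Summit.BirchSwinnertonDyer.Rank1Residual.O5.exists_goodSS_twist_pStar_of_subGss W p hp2 hadd hGss
  have hgood : V.HasGoodReductionAtPrime p := hss.1
  have hap : V.frobeniusTrace p = 0 := (V.natCast_dvd_frobeniusTrace_iff_eq_zero p hp5 hgood).mp hss.2
  -- (C1_η) at the twin
  have h1 : QuadraticBranchPlusMainConjectureAt V p := h₁ V p hp5 hgood hap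
  rcases Nat.le_one_iff_eq_zero_or_eq_one.mp hr with h0 | h1r
  · -- analytic rank 0: EXACT even control from (MC⁺_η) + (R2⁺) + Poitou–Tate, then the value identity
    haveI : NeZero (V.conductorNorm ℤ) := ⟨V.conductorNorm_pos_holds.ne'⟩
    obtain ⟨f, hf⟩ := hnf V
    obtain ⟨ϖ, hϖ, hrel⟩ := hper V f hf hgood hap
    obtain ⟨L, hL⟩ := exists_isQuadraticBranchPlusLFunction_of_isNewformOf hp2 hf hgood hap ϖ hϖ
    have hLW : W.entireLFunction 1 ≠ 0 := by
      rw [← W.leadingLCoeff_eq_of_analyticRank_eq_zero h0]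
      exact W.leadingLCoeff_ne_zero_holds (hmod W)
    exact EvenControlZero.missingPPartAt_rankZero_of_readings W p hPT hGZK hmod
      (SignedTwist.evenBranchPlusCharIdealOfPlusMCAt_of_plusMCEta W p (h₂.1 p hp5)) (h₃ W p hp5).1
      V C hp5 hCV hgood hap h1 hf hrel hL hLW
  · -- analytic rank 1: x1b's chain with the odd exact control from (MC⁻_η) + (R2⁻) + Poitou–Tate
    haveI : Finite W.sha := (hGZK W hr).2
    exact missingPPartAt_of_bsdp W p
      (LevelBridge.bsdp_of_plusMC_of_pAdicGrossZagierValuation_of_readings_of_periodRatio W p hmod hGZ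
        hGZK hPT hnf hper (h₃ W p hp5).2
        (LevelBridge.exactOddBranchReading_of_kobayashi74OddEtaExact W p (h₂.2 p hp5))
        ((quadraticBranchPAdicGrossZagierValuationAt_iff W p).mpr (h₄ W p)) hp5 hCV hgood hap h1 h1r)

/-- **The same pair theorem with the period ratio supplied by Mazur's `p ∤ c₀`** (Invent. Math. 44
(1978) Cor. 4.1, named fact `ModularForms.mazur_not_dvd_maninConstant_of_odd`, via x1b's
`periodRatio_of_mazur`): cruxes + the five published inputs + `hM` ⟹ `MissingPPartAt W p` on every Gss2
pair of analytic rank `≤ 1`, `p ≥ 5`. CONDITIONAL (named fact taken as a hypothesis); nothing booked.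
[cite: Mazur1978, Cor. 4.1] [cite: GreenbergVatsal2000, §3, Remark 3.4]
[cite: Kobayashi2003, Thm. 3.2 (p. 7), §4 (p. 8)] [cite: Miller2011LMS, §1 and Def. 1.1] -/
theorem missingPPartAt_of_signedControlCruxes_of_mazur
    (hGZK : rank_eq_analyticRank_of_analyticRank_le_one) (hmod : hasEntireLFunction_rat)
    (hnf : exists_isNewformOf) (hGZ : GrossZagier1986_thm_I_7_3)
    (hPT : poitouTate_selmerStructure_duality_real ℚ) (hM : mazur_not_dvd_maninConstant_of_odd)
    (h₁ : PlusMainConjectureBranch) (h₂ : EtaTransportSigned) (h₃ : NoFiniteSubmoduleSigned)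
    (h₄ : PAdicGrossZagierBranch)
    (W : WeierstrassCurve ℚ) [W.IsElliptic] [W.IsGloballyMinimal] (p : ℕ) [Fact p.Prime]
    (hr : W.analyticRank ≤ 1) (hp5 : 5 ≤ p) (hadd : Addv W p) (hGss : SubGss W p) :
    MissingPPartAt W p :=
  missingPPartAt_of_signedControlCruxes_of_periodRatio hGZK hmod hnf hGZ hPT h₁ h₂ h₃ h₄ W p
    (periodRatio_of_mazur p hM hp5) hr hp5 hadd hGss

end Summit.BirchSwinnertonDyer.BirchSwinnertonDyer.Theorems

end
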